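import Summits.ResolutionOfSingularities.ResolutionOfSingularities.Theorems.HilbertSamuelEliminationSigmaMaxModificationsCorridor3WLadderRecognitionNearLocusWCurve
import Summits.ResolutionOfSingularities.ResolutionOfSingularities.Theorems.HilbertSamuelEliminationSigmaMaxModificationsCorridor3WLadderRecognitionNearLocusShape
import HarnessLib

/-!
# [OURS · L1 W4.2] RECOGNITION-GEOMETRY (R2), WAITING-TOLERANT FORM WITH A PARAMETRIC POINT HYPOTHESIS `F`, PART 3: the finite case, the dichotomy (G1),
# the curve data along a tower whose centres are the near loci, CJS Def. 6.38 (iv) along the unit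
# (crux chain w42, line `w_ladder`; `--supports stmt-…-19249`, helper)

OURS (cell res-hironaka, slot W4.2, seat res-L1-w42-stub-2 gen 4); NOT statements of H. Hironaka's manuscript [Hironaka2017]
nor of [CossartJannsenSaito2020]. AI-drafted, weaker than expert review. Sorry-free PROOF file (no new definition).

`…WLadderRecognitionNearLocusShape` RE-ISSUED with the point hypothesis `F` as a parameter and STAGE-`j`-ONLY hypotheses (see PART 1
`…WFibres`): same theorem names in the namespace `BlowupTowerNearW` — `isClosed_singleton_of_mem_nearLocus_succ_of_not_dominant`, `finite_nearLocus_succ_of_not_dominant`,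
`exists_isOpen_inter_nearLocus_succ_eq_singleton_of_not_dominant`, `nearLocus_succ_finite_or_dominant`,
`isRegular_point_of_mem_nearLocus_succ_of_not_dominant`, **(G1) `nearLocus_succ_shape`**, `dominant_of_not_isolated`,
`not_dominant_of_isolated_closed`, `not_subset_image_nearLocus_succ_of_isolated_closed` (Def. 6.38 (v)),
`curveData_of_centres_eq_nearLocus`, **`inducesIsoOn_of_centres_eq_nearLocus`** (Def. 6.38 (iv) along the unit).

## References

* V. Cossart, U. Jannsen, S. Saito, LNM 2270 (2020): Thm. 3.14, Def. 6.38 (iii)–(v), proof of Thm. 6.28 Step 2 (p. 94), pp. 104–105.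
  [CossartJannsenSaito2020]
-/

noncomputable section

-- namespace `…Corridor3.Helpers` re-enters `…Corridor3`
set_option linter.dupNamespace false

open CategoryTheory AlgebraicGeometry TopologicalSpace IsLocalRing
open Literature.AlgebraicGeometry.Resolution
open Scheme.IdealSheafData

universe u

open Literature.AlgebraicGeometry.CossartJannsenSaito2020

namespace Summit.ResolutionOfSingularities.ResolutionOfSingularities.Theorems.SigmaMaxModificationsCorridor3.Helpers

namespace BlowupTowerNearW

/-! The point hypothesis `F` (the rôle of (F1) `CharHypothesis` / (F1♯) `GeomDirHypothesis`) and the binders keyed on it are SECTION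
VARIABLES: every theorem below takes them as its FIRST explicit arguments, in the order `F`, `h314f`[, `hPb`, `h314`]. -/

variable {T : BlowupTower.{u}} {N : ℕ}
  (F : ∀ (X : Scheme.{u}) [IsLocallyNoetherian X], X → Prop)
  (h314f : ∀ (X X' : Scheme.{u}) [IsLocallyNoetherian X] (π : X' ⟶ X) (D : X.IdealSheafData),
    Scheme.IsExcellent X → IdealSheafData.IsPermissible D → IsBlowup π D →
      ∀ N : ℕ, topologicalKrullDim X ≤ (N : WithBot ℕ∞) →
        ∀ x : X, x ∈ D.support → F X x →
          (Scheme.dirDim X x : WithBot ℕ∞) ≤ ringKrullDim (X.presheaf.stalk x ⧸ stalkIdeal D x) + 1 →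
            {x' : X' | π.base x' = x ∧ Scheme.hsFun X' N x' = Scheme.hsFun X N x}.Subsingleton)

section Finite

include h314f

/-- **FINITE CASE: every point of `N_{j+1}(x)` is CLOSED.** [cite: CossartJannsenSaito2020, p. 94] -/
theorem isClosed_singleton_of_mem_nearLocus_succ_of_not_dominant (hT36 : CossartJannsenSaito2020_thm_3_6.{u})
    (h3104 : CossartJannsenSaito2020_thm_3_10_4.{u}) (hkey : KeySetting T N)
    (hperm : ∀ j, IdealSheafData.IsPermissible (T.centreIdeal j))
    (hcl : ∀ (j : ℕ) (μ : ℕ → ℕ), IsClosed (Scheme.hsStratumGE (T.X j) N μ))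
    {x : T.X 0} (hx : IsClosed ({x} : Set (T.X 0)))
    (hF : ∀ i, ∀ y ∈ T.nearLocus N x i, @F (T.X i) (T.ln i) y) (hē : T.geomDirDimAt 0 x ≤ 2) {j : ℕ}
    (hNC : T.nearLocus N x j ⊆ T.C j) (hCN : T.C j ⊆ T.nearLocus N x j)
    (hirr : IsIrreducible (T.C j)) (hnt : (T.C j).Nontrivial)
    (hpts : ∀ y ∈ T.C j, ¬ IsGenericPoint y (T.C j) → IsClosed ({y} : Set (T.X j)))
    {η : T.X j} (hη : IsGenericPoint η (T.C j)) (hfin : η ∉ (T.π j).base '' T.nearLocus N x (j + 1)) :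
    ∀ z ∈ T.nearLocus N x (j + 1), IsClosed ({z} : Set (T.X (j + 1))) :=
  fun z hz => isClosed_singleton_of_mem_nearLocus_succ F h314f hT36 h3104 hkey hperm hcl hx hF hē hNC hCN hirr hnt hpts hz
    (fun h => hfin ⟨z, hz, h.eq hη⟩)

/-- **FINITE CASE: `N_{j+1}(x)` is a FINITE set** (a closed subset of a noetherian stage all of whose points are closed).
[cite: CossartJannsenSaito2020, p. 94] -/
theorem finite_nearLocus_succ_of_not_dominant [IsNoetherian (T.X 0)] (hT36 : CossartJannsenSaito2020_thm_3_6.{u})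
    (h3104 : CossartJannsenSaito2020_thm_3_10_4.{u}) (hkey : KeySetting T N)
    (hperm : ∀ j, IdealSheafData.IsPermissible (T.centreIdeal j))
    (hcl : ∀ (j : ℕ) (μ : ℕ → ℕ), IsClosed (Scheme.hsStratumGE (T.X j) N μ))
    {x : T.X 0} (hx : IsClosed ({x} : Set (T.X 0)))
    (hF : ∀ i, ∀ y ∈ T.nearLocus N x i, @F (T.X i) (T.ln i) y) (hē : T.geomDirDimAt 0 x ≤ 2) {j : ℕ}
    (hNC : T.nearLocus N x j ⊆ T.C j) (hCN : T.C j ⊆ T.nearLocus N x j)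
    (hirr : IsIrreducible (T.C j)) (hnt : (T.C j).Nontrivial)
    (hpts : ∀ y ∈ T.C j, ¬ IsGenericPoint y (T.C j) → IsClosed ({y} : Set (T.X j)))
    {η : T.X j} (hη : IsGenericPoint η (T.C j)) (hfin : η ∉ (T.π j).base '' T.nearLocus N x (j + 1)) :
    (T.nearLocus N x (j + 1)).Finite := by
  haveI : IsNoetherian (T.X (j + 1)) := BlowupTowerNear.isNoetherian T (j + 1)
  have hN : IsClosed (T.nearLocus N x (j + 1)) := BlowupTowerNear.isClosed_nearLocus T hkey hperm hcl hx (j + 1)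
  have hzcl := isClosed_singleton_of_mem_nearLocus_succ_of_not_dominant F h314f hT36 h3104 hkey hperm hcl hx hF hē hNC hCN hirr
    hnt hpts hη hfin
  obtain ⟨S, hSfin, hScl, hSirr, hS⟩ := NoetherianSpace.exists_finite_set_isClosed_irreducible hN
  have hsing : ∀ t ∈ S, ∃ z : T.X (j + 1), t = {z} := by
    intro t ht
    have hζ : IsGenericPoint (hSirr t ht).genericPoint t := (hSirr t ht).isGenericPoint_genericPoint (hScl t ht)
    have hζN : (hSirr t ht).genericPoint ∈ T.nearLocus N x (j + 1) := by
      rw [hS]; exact Set.mem_sUnion_of_mem hζ.mem ht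
    refine ⟨(hSirr t ht).genericPoint, ?_⟩
    have h1 : closure {(hSirr t ht).genericPoint} = t := hζ.def
    rw [(hzcl _ hζN).closure_eq] at h1
    exact h1.symm
  rw [hS]
  refine Set.Finite.sUnion hSfin fun t ht => ?_
  obtain ⟨z, rfl⟩ := hsing t ht
  exact Set.finite_singleton z

/-- **FINITE CASE: every point of `N_{j+1}(x)` is ISOLATED in it** — in particular the marked point of the chain is isolated in its
near locus (the `Iso` reading of the end of a fundamental unit). [cite: CossartJannsenSaito2020, Def. 6.38 (v), p. 105] -/
theorem exists_isOpen_inter_nearLocus_succ_eq_singleton_of_not_dominant [IsNoetherian (T.X 0)] (hT36 : CossartJannsenSaito2020_thm_3_6.{u})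
    (h3104 : CossartJannsenSaito2020_thm_3_10_4.{u}) (hkey : KeySetting T N)
    (hperm : ∀ j, IdealSheafData.IsPermissible (T.centreIdeal j))
    (hcl : ∀ (j : ℕ) (μ : ℕ → ℕ), IsClosed (Scheme.hsStratumGE (T.X j) N μ))
    {x : T.X 0} (hx : IsClosed ({x} : Set (T.X 0)))
    (hF : ∀ i, ∀ y ∈ T.nearLocus N x i, @F (T.X i) (T.ln i) y) (hē : T.geomDirDimAt 0 x ≤ 2) {j : ℕ}
    (hNC : T.nearLocus N x j ⊆ T.C j) (hCN : T.C j ⊆ T.nearLocus N x j)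
    (hirr : IsIrreducible (T.C j)) (hnt : (T.C j).Nontrivial)
    (hpts : ∀ y ∈ T.C j, ¬ IsGenericPoint y (T.C j) → IsClosed ({y} : Set (T.X j)))
    {η : T.X j} (hη : IsGenericPoint η (T.C j)) (hfin : η ∉ (T.π j).base '' T.nearLocus N x (j + 1)) :
    ∀ z ∈ T.nearLocus N x (j + 1), ∃ U : Set (T.X (j + 1)), IsOpen U ∧ U ∩ T.nearLocus N x (j + 1) = {z} := by
  intro z hz
  have hFin := finite_nearLocus_succ_of_not_dominant F h314f hT36 h3104 hkey hperm hcl hx hF hē hNC hCN hirr hnt hpts hη hfin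
  have hzcl := isClosed_singleton_of_mem_nearLocus_succ_of_not_dominant F h314f hT36 h3104 hkey hperm hcl hx hF hē hNC hCN hirr
    hnt hpts hη hfin
  have hrest : IsClosed (⋃ w ∈ T.nearLocus N x (j + 1) \ {z}, ({w} : Set (T.X (j + 1)))) :=
    (hFin.subset fun _ hw => hw.1).isClosed_biUnion fun w hw => hzcl w hw.1
  refine ⟨(⋃ w ∈ T.nearLocus N x (j + 1) \ {z}, ({w} : Set (T.X (j + 1))))ᶜ, hrest.isOpen_compl, ?_⟩
  ext w
  simp only [Set.mem_inter_iff, Set.mem_compl_iff, Set.mem_iUnion, Set.mem_singleton_iff, exists_prop, not_exists, not_and]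
  constructor
  · rintro ⟨h1, h2⟩
    by_contra hne
    exact h1 w ⟨h2, hne⟩ rfl
  · rintro rfl
    exact ⟨fun v hv hwv => hv.2 hwv.symm, hz⟩

/-- **THE DICHOTOMY (G1): `N_{j+1}(x)` is FINITE, or it DOMINATES `C_j`** (and then it is an irreducible curve mapped isomorphically
onto `C_j`, see the `_of_dominant` family). [cite: CossartJannsenSaito2020, p. 94, p. 104] -/
theorem nearLocus_succ_finite_or_dominant [IsNoetherian (T.X 0)] (hT36 : CossartJannsenSaito2020_thm_3_6.{u})
    (h3104 : CossartJannsenSaito2020_thm_3_10_4.{u}) (hkey : KeySetting T N)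
    (hperm : ∀ j, IdealSheafData.IsPermissible (T.centreIdeal j))
    (hcl : ∀ (j : ℕ) (μ : ℕ → ℕ), IsClosed (Scheme.hsStratumGE (T.X j) N μ))
    {x : T.X 0} (hx : IsClosed ({x} : Set (T.X 0)))
    (hF : ∀ i, ∀ y ∈ T.nearLocus N x i, @F (T.X i) (T.ln i) y) (hē : T.geomDirDimAt 0 x ≤ 2) {j : ℕ}
    (hNC : T.nearLocus N x j ⊆ T.C j) (hCN : T.C j ⊆ T.nearLocus N x j)
    (hirr : IsIrreducible (T.C j)) (hnt : (T.C j).Nontrivial)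
    (hpts : ∀ y ∈ T.C j, ¬ IsGenericPoint y (T.C j) → IsClosed ({y} : Set (T.X j)))
    {η : T.X j} (hη : IsGenericPoint η (T.C j)) :
    (T.nearLocus N x (j + 1)).Finite ∨ η ∈ (T.π j).base '' T.nearLocus N x (j + 1) := by
  by_cases hdom : η ∈ (T.π j).base '' T.nearLocus N x (j + 1)
  · exact Or.inr hdom
  · exact Or.inl (finite_nearLocus_succ_of_not_dominant F h314f hT36 h3104 hkey hperm hcl hx hF hē hNC hCN hirr hnt hpts hη hdom)

/-- **(G2), FINITE CASE: every point of `N_{j+1}(x)` is a closed point whose reduced point subscheme is REGULAR** (so any class of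
them is a disjoint union of regular points; a closed point is a permissible centre iff it is not a component,
`isPermissible_vanishingIdeal_singleton_iff`). [cite: CossartJannsenSaito2020, p. 94] -/
theorem isRegular_point_of_mem_nearLocus_succ_of_not_dominant (hT36 : CossartJannsenSaito2020_thm_3_6.{u})
    (h3104 : CossartJannsenSaito2020_thm_3_10_4.{u}) (hkey : KeySetting T N)
    (hperm : ∀ j, IdealSheafData.IsPermissible (T.centreIdeal j))
    (hcl : ∀ (j : ℕ) (μ : ℕ → ℕ), IsClosed (Scheme.hsStratumGE (T.X j) N μ))
    {x : T.X 0} (hx : IsClosed ({x} : Set (T.X 0)))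
    (hF : ∀ i, ∀ y ∈ T.nearLocus N x i, @F (T.X i) (T.ln i) y) (hē : T.geomDirDimAt 0 x ≤ 2) {j : ℕ}
    (hNC : T.nearLocus N x j ⊆ T.C j) (hCN : T.C j ⊆ T.nearLocus N x j)
    (hirr : IsIrreducible (T.C j)) (hnt : (T.C j).Nontrivial)
    (hpts : ∀ y ∈ T.C j, ¬ IsGenericPoint y (T.C j) → IsClosed ({y} : Set (T.X j)))
    {η : T.X j} (hη : IsGenericPoint η (T.C j)) (hfin : η ∉ (T.π j).base '' T.nearLocus N x (j + 1))
    {z : T.X (j + 1)} (hz : z ∈ T.nearLocus N x (j + 1)) :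
    ∃ hzcl : IsClosed ({z} : Set (T.X (j + 1))),
      Scheme.IsRegular (vanishingIdeal (⟨{z}, hzcl⟩ : Closeds (T.X (j + 1)))).subscheme := by
  haveI : ∀ j, IsLocallyNoetherian (T.X j) := T.ln
  have hzcl := isClosed_singleton_of_mem_nearLocus_succ_of_not_dominant F h314f hT36 h3104 hkey hperm hcl hx hF hē hNC hCN hirr hnt hpts hη hfin z hz
  exact ⟨hzcl, isRegular_subscheme_vanishingIdeal_singleton hzcl⟩

/-- **(G1) IN ONE STATEMENT — the SHAPE of the near locus over a curve centre.** Under the hypotheses of §2 at stage `j`, EITHER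
`N_{j+1}(x)` is a finite set of closed points, each isolated in it, not covering `C_j` (CJS Def. 6.38 (v): the unit ENDS), OR
`π_{j+1}` maps `N_{j+1}(x)` bijectively onto `C_j` and `N_{j+1}(x)` is a closed irreducible positive-dimensional set whose non-generic
points are closed (the unit CONTINUES with `C_{j+1} = N_{j+1}(x) ⥲ C_j`, `inducesIsoOn_nearLocus_succ_of_dominant`, and the
hypotheses reproduce at stage `j + 1`). [cite: CossartJannsenSaito2020, Def. 6.38 (iii)–(v), p. 94, p. 104] -/
theorem nearLocus_succ_shape [IsNoetherian (T.X 0)] (hT36 : CossartJannsenSaito2020_thm_3_6.{u})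
    (h3104 : CossartJannsenSaito2020_thm_3_10_4.{u}) (hkey : KeySetting T N)
    (hperm : ∀ j, IdealSheafData.IsPermissible (T.centreIdeal j))
    (hcl : ∀ (j : ℕ) (μ : ℕ → ℕ), IsClosed (Scheme.hsStratumGE (T.X j) N μ))
    {x : T.X 0} (hx : IsClosed ({x} : Set (T.X 0)))
    (hF : ∀ i, ∀ y ∈ T.nearLocus N x i, @F (T.X i) (T.ln i) y) (hē : T.geomDirDimAt 0 x ≤ 2) {j : ℕ}
    (hNC : T.nearLocus N x j ⊆ T.C j) (hCN : T.C j ⊆ T.nearLocus N x j)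
    (hirr : IsIrreducible (T.C j)) (hnt : (T.C j).Nontrivial)
    (hpts : ∀ y ∈ T.C j, ¬ IsGenericPoint y (T.C j) → IsClosed ({y} : Set (T.X j)))
    {η : T.X j} (hη : IsGenericPoint η (T.C j)) :
    ((T.nearLocus N x (j + 1)).Finite ∧
        (∀ z ∈ T.nearLocus N x (j + 1), IsClosed ({z} : Set (T.X (j + 1)))) ∧
        (∀ z ∈ T.nearLocus N x (j + 1), ∃ U : Set (T.X (j + 1)), IsOpen U ∧ U ∩ T.nearLocus N x (j + 1) = {z}) ∧
        ¬ (T.C j ⊆ (T.π j).base '' T.nearLocus N x (j + 1))) ∨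
      ((T.π j).base '' T.nearLocus N x (j + 1) = T.C j ∧
        Set.BijOn (T.π j).base (T.nearLocus N x (j + 1)) (T.C j) ∧
        IsClosed (T.nearLocus N x (j + 1)) ∧ IsIrreducible (T.nearLocus N x (j + 1)) ∧
        (T.nearLocus N x (j + 1)).Nontrivial ∧
        (∀ z ∈ T.nearLocus N x (j + 1), ¬ IsGenericPoint z (T.nearLocus N x (j + 1)) → IsClosed ({z} : Set (T.X (j + 1))))) := by
  by_cases hdom : η ∈ (T.π j).base '' T.nearLocus N x (j + 1)
  · exact Or.inr ⟨BlowupTowerNear.image_nearLocus_succ_eq_of_dominant T hkey hperm hcl hx (hNC) hη hdom,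
      bijOn_nearLocus_succ_of_dominant F h314f hT36 h3104 hkey hperm hcl hx hF hē hNC hCN hirr hnt hpts hη hdom, BlowupTowerNear.isClosed_nearLocus T hkey hperm hcl hx (j + 1),
      isIrreducible_nearLocus_succ_of_dominant F h314f hT36 h3104 hkey hperm hcl hx hF hē hNC hCN hirr hnt hpts hη hdom, nontrivial_nearLocus_succ_of_dominant F h314f hT36 h3104 hkey hperm hcl hx hF hē hNC hCN hirr hnt hpts hη hdom,
      isClosed_singleton_of_mem_nearLocus_succ_of_dominant F h314f hT36 h3104 hkey hperm hcl hx hF hē hNC hCN hirr hnt hpts hη hdom⟩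
  · exact Or.inl ⟨finite_nearLocus_succ_of_not_dominant F h314f hT36 h3104 hkey hperm hcl hx hF hē hNC hCN hirr hnt hpts hη hdom,
      isClosed_singleton_of_mem_nearLocus_succ_of_not_dominant F h314f hT36 h3104 hkey hperm hcl hx hF hē hNC hCN hirr hnt hpts hη hdom,
      exists_isOpen_inter_nearLocus_succ_eq_singleton_of_not_dominant F h314f hT36 h3104 hkey hperm hcl hx hF hē hNC hCN hirr hnt hpts hη hdom,
      BlowupTowerNear.not_subset_image_nearLocus_succ_of_not_dominant hη hdom⟩

/-- **If some point of `N_{j+1}(x)` is NOT isolated in it, the near locus DOMINATES `C_j`** (the form used along a unit: at an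
interior stage the marked point `x_{j+1} ∈ N_{j+1}(x)` is not isolated in its stratum). [cite: CossartJannsenSaito2020, Def. 6.38, p. 105] -/
theorem dominant_of_not_isolated [IsNoetherian (T.X 0)] (hT36 : CossartJannsenSaito2020_thm_3_6.{u})
    (h3104 : CossartJannsenSaito2020_thm_3_10_4.{u}) (hkey : KeySetting T N)
    (hperm : ∀ j, IdealSheafData.IsPermissible (T.centreIdeal j))
    (hcl : ∀ (j : ℕ) (μ : ℕ → ℕ), IsClosed (Scheme.hsStratumGE (T.X j) N μ))
    {x : T.X 0} (hx : IsClosed ({x} : Set (T.X 0)))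
    (hF : ∀ i, ∀ y ∈ T.nearLocus N x i, @F (T.X i) (T.ln i) y) (hē : T.geomDirDimAt 0 x ≤ 2) {j : ℕ}
    (hNC : T.nearLocus N x j ⊆ T.C j) (hCN : T.C j ⊆ T.nearLocus N x j)
    (hirr : IsIrreducible (T.C j)) (hnt : (T.C j).Nontrivial)
    (hpts : ∀ y ∈ T.C j, ¬ IsGenericPoint y (T.C j) → IsClosed ({y} : Set (T.X j)))
    {η : T.X j} (hη : IsGenericPoint η (T.C j)) {z : T.X (j + 1)} (hz : z ∈ T.nearLocus N x (j + 1))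
    (hniso : ¬ ∃ U : Set (T.X (j + 1)), IsOpen U ∧ U ∩ T.nearLocus N x (j + 1) = {z}) :
    η ∈ (T.π j).base '' T.nearLocus N x (j + 1) := by
  by_contra hdom
  exact hniso (exists_isOpen_inter_nearLocus_succ_eq_singleton_of_not_dominant F h314f hT36 h3104 hkey hperm hcl hx hF hē hNC hCN hirr hnt hpts hη hdom z hz)

/-- **A CLOSED point of `N_{j+1}(x)` which is ISOLATED in it rules out the dominant case** (in the dominant case `N_{j+1}(x)` is
irreducible and nontrivial, so its generic point is not closed and lies in every open set meeting `N_{j+1}(x)`). The marked point of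
a chain at an `Iso` stage is such a point. [cite: CossartJannsenSaito2020, Def. 6.38 (v), p. 105] -/
theorem not_dominant_of_isolated_closed (hT36 : CossartJannsenSaito2020_thm_3_6.{u})
    (h3104 : CossartJannsenSaito2020_thm_3_10_4.{u}) (hkey : KeySetting T N)
    (hperm : ∀ j, IdealSheafData.IsPermissible (T.centreIdeal j))
    (hcl : ∀ (j : ℕ) (μ : ℕ → ℕ), IsClosed (Scheme.hsStratumGE (T.X j) N μ))
    {x : T.X 0} (hx : IsClosed ({x} : Set (T.X 0)))
    (hF : ∀ i, ∀ y ∈ T.nearLocus N x i, @F (T.X i) (T.ln i) y) (hē : T.geomDirDimAt 0 x ≤ 2)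
    {j : ℕ}
    (hNC : T.nearLocus N x j ⊆ T.C j) (hCN : T.C j ⊆ T.nearLocus N x j)
    (hirr : IsIrreducible (T.C j)) (hnt : (T.C j).Nontrivial)
    (hpts : ∀ y ∈ T.C j, ¬ IsGenericPoint y (T.C j) → IsClosed ({y} : Set (T.X j)))
    {η : T.X j} (hη : IsGenericPoint η (T.C j)) {z : T.X (j + 1)} (hzcl : IsClosed ({z} : Set (T.X (j + 1))))
    (hiso : ∃ U : Set (T.X (j + 1)), IsOpen U ∧ U ∩ T.nearLocus N x (j + 1) = {z}) :
    η ∉ (T.π j).base '' T.nearLocus N x (j + 1) := by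
  intro hdom
  have hirr' := isIrreducible_nearLocus_succ_of_dominant F h314f hT36 h3104 hkey hperm hcl hx hF hē hNC hCN hirr hnt hpts hη hdom
  have hnt' := nontrivial_nearLocus_succ_of_dominant F h314f hT36 h3104 hkey hperm hcl hx hF hē hNC hCN hirr hnt hpts hη hdom
  have hN : IsClosed (T.nearLocus N x (j + 1)) := BlowupTowerNear.isClosed_nearLocus T hkey hperm hcl hx (j + 1)
  have hζ : IsGenericPoint hirr'.genericPoint (T.nearLocus N x (j + 1)) := hirr'.isGenericPoint_genericPoint hN
  -- `z` is not the generic point: its closure is `{z}`, not the nontrivial `N_{j+1}(x)`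
  have hne : hirr'.genericPoint ≠ z := by
    intro h
    have h1 : T.nearLocus N x (j + 1) = {z} := by rw [← hζ.def, h, hzcl.closure_eq]
    obtain ⟨w, hw, hwz⟩ := hnt'.exists_ne z
    exact hwz (by rw [h1] at hw; exact hw)
  -- but the generic point lies in the open `U` isolating `z`
  obtain ⟨U, hU, hUz⟩ := hiso
  have hζU : hirr'.genericPoint ∈ U :=
    (hζ.mem_open_set_iff hU).mpr ⟨z, by rw [Set.inter_comm, hUz]; exact Set.mem_singleton z⟩
  have : hirr'.genericPoint ∈ U ∩ T.nearLocus N x (j + 1) := ⟨hζU, hζ.mem⟩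
  rw [hUz] at this
  exact hne this

/-- **CJS Def. 6.38 (v) from an isolated closed near point**: if some closed point of `N_{j+1}(x)` is isolated in it (e.g. the marked
point at an `Iso` stage), then `π_{j+1} : N_{j+1}(x) → C_j` is NOT surjective. [cite: CossartJannsenSaito2020, Def. 6.38 (v), p. 105] -/
theorem not_subset_image_nearLocus_succ_of_isolated_closed (hT36 : CossartJannsenSaito2020_thm_3_6.{u})
    (h3104 : CossartJannsenSaito2020_thm_3_10_4.{u}) (hkey : KeySetting T N)
    (hperm : ∀ j, IdealSheafData.IsPermissible (T.centreIdeal j))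
    (hcl : ∀ (j : ℕ) (μ : ℕ → ℕ), IsClosed (Scheme.hsStratumGE (T.X j) N μ))
    {x : T.X 0} (hx : IsClosed ({x} : Set (T.X 0)))
    (hF : ∀ i, ∀ y ∈ T.nearLocus N x i, @F (T.X i) (T.ln i) y) (hē : T.geomDirDimAt 0 x ≤ 2)
    {j : ℕ}
    (hNC : T.nearLocus N x j ⊆ T.C j) (hCN : T.C j ⊆ T.nearLocus N x j)
    (hirr : IsIrreducible (T.C j)) (hnt : (T.C j).Nontrivial)
    (hpts : ∀ y ∈ T.C j, ¬ IsGenericPoint y (T.C j) → IsClosed ({y} : Set (T.X j)))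
    {z : T.X (j + 1)} (hzcl : IsClosed ({z} : Set (T.X (j + 1))))
    (hiso : ∃ U : Set (T.X (j + 1)), IsOpen U ∧ U ∩ T.nearLocus N x (j + 1) = {z}) :
    ¬ (T.C j ⊆ (T.π j).base '' T.nearLocus N x (j + 1)) :=
  have hη : IsGenericPoint hirr.genericPoint (T.C j) := hirr.isGenericPoint_genericPoint (T.isClosed_C j)
  BlowupTowerNear.not_subset_image_nearLocus_succ_of_not_dominant hη
    (not_dominant_of_isolated_closed F h314f hT36 h3104 hkey hperm hcl hx hF hē hNC hCN hirr hnt hpts hη hzcl hiso)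

/-- **THE CURVE DATA PROPAGATE along a tower whose centres are the near loci.** If `C_0 = {x}`, `C_i = N_i(x)` for `1 ≤ i ≤ q`,
`C_1` is an irreducible positive-dimensional set with closed non-generic points (`ℙ(Dir_x) ≅ ℙ¹`, (R1)/P-a), and at every stage
`2 ≤ i ≤ q` some CLOSED point of `N_i(x)` is NOT isolated in it (the marked point at a non-`Iso` stage), then EVERY `C_i`
(`1 ≤ i ≤ q`) is irreducible, nontrivial, with closed non-generic points — so the one-step theorems apply at every stage `≤ q`.
[cite: CossartJannsenSaito2020, Def. 6.38 (iii)–(iv), p. 104] -/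
theorem curveData_of_centres_eq_nearLocus [IsNoetherian (T.X 0)] (hT36 : CossartJannsenSaito2020_thm_3_6.{u})
    (h3104 : CossartJannsenSaito2020_thm_3_10_4.{u}) (hkey : KeySetting T N)
    (hperm : ∀ j, IdealSheafData.IsPermissible (T.centreIdeal j))
    (hcl : ∀ (j : ℕ) (μ : ℕ → ℕ), IsClosed (Scheme.hsStratumGE (T.X j) N μ))
    {x : T.X 0} (hx : IsClosed ({x} : Set (T.X 0)))
    (hF : ∀ i, ∀ y ∈ T.nearLocus N x i, @F (T.X i) (T.ln i) y) (hē : T.geomDirDimAt 0 x ≤ 2)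
    (hC0 : T.C 0 = {x}) {q : ℕ} (hCq : ∀ i, 1 ≤ i → i ≤ q → T.C i = T.nearLocus N x i)
    (h1irr : IsIrreducible (T.C 1)) (h1nt : (T.C 1).Nontrivial)
    (h1pts : ∀ y ∈ T.C 1, ¬ IsGenericPoint y (T.C 1) → IsClosed ({y} : Set (T.X 1)))
    (hniso : ∀ i, 2 ≤ i → i ≤ q → ∃ z ∈ T.nearLocus N x i, IsClosed ({z} : Set (T.X i)) ∧
      ¬ ∃ U : Set (T.X i), IsOpen U ∧ U ∩ T.nearLocus N x i = {z}) :
    ∀ i, 1 ≤ i → i ≤ q → IsIrreducible (T.C i) ∧ (T.C i).Nontrivial ∧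
      (∀ y ∈ T.C i, ¬ IsGenericPoint y (T.C i) → IsClosed ({y} : Set (T.X i))) := by
  -- `N_i ⊆ C_i` for all `i ≤ q`
  have hNC : ∀ i, i ≤ q → T.nearLocus N x i ⊆ T.C i := by
    intro i hi
    rcases Nat.eq_zero_or_pos i with rfl | hpos
    · rw [BlowupTower.nearLocus_zero, hC0]
    · exact (hCq i hpos hi).symm.subset
  intro i
  induction i with
  | zero => intro h; exact absurd h (by omega)
  | succ i ih =>
    intro _ hiq
    rcases Nat.eq_zero_or_pos i with rfl | hpos
    · exact ⟨h1irr, h1nt, h1pts⟩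
    · obtain ⟨hirr, hnt, hpts⟩ := ih hpos (by omega)
      have hCN : T.C i ⊆ T.nearLocus N x i := (hCq i hpos (by omega)).subset
      have hNC' : T.nearLocus N x i ⊆ T.C i := hNC i (by omega)
      have hη : IsGenericPoint hirr.genericPoint (T.C i) := hirr.isGenericPoint_genericPoint (T.isClosed_C i)
      obtain ⟨z, hz, hzcl, hzniso⟩ := hniso (i + 1) (by omega) hiq
      have hdom : hirr.genericPoint ∈ (T.π i).base '' T.nearLocus N x (i + 1) := by
        by_contra hfin
        exact hzniso (exists_isOpen_inter_nearLocus_succ_eq_singleton_of_not_dominant F h314f hT36 h3104 hkey hperm hcl hx hF hē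
          hNC' hCN hirr hnt hpts hη hfin z hz)
      rw [hCq (i + 1) (by omega) hiq]
      exact ⟨isIrreducible_nearLocus_succ_of_dominant F h314f hT36 h3104 hkey hperm hcl hx hF hē hNC' hCN hirr hnt hpts hη hdom,
        nontrivial_nearLocus_succ_of_dominant F h314f hT36 h3104 hkey hperm hcl hx hF hē hNC' hCN hirr hnt hpts hη hdom,
        isClosed_singleton_of_mem_nearLocus_succ_of_dominant F h314f hT36 h3104 hkey hperm hcl hx hF hē hNC' hCN hirr hnt hpts
          hη hdom⟩

end Finite

section Iso

variable
  (hPb : ∀ (X X' : Scheme.{u}) [IsLocallyNoetherian X] [IsLocallyNoetherian X'] (π : X' ⟶ X) (D : X.IdealSheafData),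
    Scheme.IsExcellent X → IdealSheafData.IsPermissible D → IsBlowup π D →
      ∀ N : ℕ, topologicalKrullDim ↥X ≤ (N : WithBot ℕ∞) →
        ∀ x' : X', π.base x' ∈ D.support → stalkIdeal D (π.base x') = maximalIdeal _ →
          F X (π.base x') → Scheme.dirDim X (π.base x') = 1 →
            Scheme.hsFun X' N x' = Scheme.hsFun X N (π.base x') → IsIso (π.residueFieldMap x'))
  (h314 : ∀ (X X' : Scheme.{u}) [IsLocallyNoetherian X] [IsLocallyNoetherian X'] (π : X' ⟶ X) (D : X.IdealSheafData),
    Scheme.IsExcellent X → IdealSheafData.IsPermissible D → IsBlowup π D →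
      ∀ N : ℕ, topologicalKrullDim X ≤ (N : WithBot ℕ∞) →
        ∀ x' : X', π.base x' ∈ D.support → F X (π.base x') →
          Scheme.hsFun X' N x' = Scheme.hsFun X N (π.base x') →
            ringKrullDim (X.presheaf.stalk (π.base x') ⧸ stalkIdeal D (π.base x')) <
              (Scheme.dirDim X (π.base x') : WithBot ℕ∞))

include h314f hPb h314

/-- **CJS Def. 6.38 (iv) ALONG THE UNIT: `π_{j+1}` induces an isomorphism `C_{j+1} ⥲ C_j` for `1 ≤ j`, `j + 1 ≤ q`** — the `iso`
clause of `IsFundamentalUnit` / stub-1's `Seg.UnitCentreDiscipline`, for a tower whose centres are the near loci up to stage `q`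
(hypotheses of `curveData_of_centres_eq_nearLocus`; binders `hPb`, `h314`). [cite: CossartJannsenSaito2020, Def. 6.38 (iv), p. 104] -/
theorem inducesIsoOn_of_centres_eq_nearLocus [IsNoetherian (T.X 0)]
    (hT36 : CossartJannsenSaito2020_thm_3_6.{u})
    (h3104 : CossartJannsenSaito2020_thm_3_10_4.{u}) (hkey : KeySetting T N)
    (hperm : ∀ j, IdealSheafData.IsPermissible (T.centreIdeal j))
    (hcl : ∀ (j : ℕ) (μ : ℕ → ℕ), IsClosed (Scheme.hsStratumGE (T.X j) N μ))
    {x : T.X 0} (hx : IsClosed ({x} : Set (T.X 0)))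
    (hF : ∀ i, ∀ y ∈ T.nearLocus N x i, @F (T.X i) (T.ln i) y) (hē : T.geomDirDimAt 0 x ≤ 2)
    (hC0 : T.C 0 = {x}) {q : ℕ} (hCq : ∀ i, 1 ≤ i → i ≤ q → T.C i = T.nearLocus N x i)
    (h1irr : IsIrreducible (T.C 1)) (h1nt : (T.C 1).Nontrivial)
    (h1pts : ∀ y ∈ T.C 1, ¬ IsGenericPoint y (T.C 1) → IsClosed ({y} : Set (T.X 1)))
    (hniso : ∀ i, 2 ≤ i → i ≤ q → ∃ z ∈ T.nearLocus N x i, IsClosed ({z} : Set (T.X i)) ∧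
      ¬ ∃ U : Set (T.X i), IsOpen U ∧ U ∩ T.nearLocus N x i = {z}) :
    ∀ j, 1 ≤ j → j + 1 ≤ q → InducesIsoOn (T.π j) (T.C (j + 1)) (T.isClosed_C (j + 1)) (T.C j) (T.isClosed_C j) := by
  intro j hj hjq
  have hNC : T.nearLocus N x j ⊆ T.C j := (hCq j hj (by omega)).symm.subset
  obtain ⟨hirr, hnt, hpts⟩ :=
    curveData_of_centres_eq_nearLocus F h314f hT36 h3104 hkey hperm hcl hx hF hē hC0 hCq h1irr h1nt h1pts hniso j hj (by omega)
  have hCN : T.C j ⊆ T.nearLocus N x j := (hCq j hj (by omega)).subset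
  have hη : IsGenericPoint hirr.genericPoint (T.C j) := hirr.isGenericPoint_genericPoint (T.isClosed_C j)
  obtain ⟨z, hz, hzcl, hzniso⟩ := hniso (j + 1) (by omega) hjq
  have hdom : hirr.genericPoint ∈ (T.π j).base '' T.nearLocus N x (j + 1) := by
    by_contra hfin
    exact hzniso (exists_isOpen_inter_nearLocus_succ_eq_singleton_of_not_dominant F h314f hT36 h3104 hkey hperm hcl hx hF hē
      hNC hCN hirr hnt hpts hη hfin z hz)
  exact (inducesIsoOn_nearLocus_succ_of_dominant F h314f hPb h314 hT36 h3104 hkey hperm hcl hx hF hē hNC hCN hirr hnt hpts hη hdom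
    (BlowupTowerNear.isClosed_nearLocus T hkey hperm hcl hx (j + 1))).of_eq (hCq (j + 1) (by omega) hjq).symm

end Iso

end BlowupTowerNearW

end Summit.ResolutionOfSingularities.ResolutionOfSingularities.Theorems.SigmaMaxModificationsCorridor3.Helpers

end
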